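import Summits.RiemannHypothesis.RiemannHypothesis.Theorems.WeilFormatCDataO106FrontData
import Summits.RiemannHypothesis.RiemannHypothesis.Theorems.S2FormatCE0
import Literature.NumberTheory.LFunctions.YoshidaWindowGramTailMSSines
import Literature.NumberTheory.LFunctions.YoshidaWindowGramMiddleJBox
import Literature.NumberTheory.LFunctions.YoshidaWindowGramTailJFactoredScaled
import Literature.NumberTheory.LFunctions.YoshidaWindowGramTailMSFactored
import Literature.NumberTheory.LFunctions.YoshidaWindowGramTailJDiagTight
import Summits.RiemannHypothesis.RiemannHypothesis.Theorems.FormatCPsdBands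
import Summits.RiemannHypothesis.RiemannHypothesis.Theorems.WeilFormatCDiagShift
import Summits.RiemannHypothesis.RiemannHypothesis.Theorems.FormatCPsdSymmBands
import HarnessLib

/-!
# Format C kernel rung `O106` (a = 53/50, column-band layout): odd sector: Schur rows 78…84 (lower triangle) of `M − U₁ − U₂` enclosed by `DS` within `rho`·2^-310 (kernel certificates)

Window `a = 53/50`; prime powers in the window: 2, 3, 2^2, 5, 7, 2^3; prime constant A = 2358/1000 (`WeilFormatC.primeCoeff_form_ge_cells_1098`); evaluator parameters S = 2^320, Kpi 160, Kser 190, kred 8, Kexp 55, J 150; full table modes < 321; light column table modes < 2051; units 2^-310 (Schur entries), 2^-154 (column digits, width 157), 2^-148 (tail-factor digits, width 151), 2^-64 (reciprocal weights), 2^-40 (tail base); order-J tail J = 4, θ = 1/2048, η = 1/10 | 4/1.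
Design row: sr-gb-rung-b B g21 hp odd λ-run (parity CELL 15 L-side, the first window PAST the (log 8)/2 resonance): a = 53/50, SIX prime powers 2,3,4,5,7,8 (kmax 8), A = 2358/1000 (WeilFormatC.primeCoeff_form_ge_cells_1098), μ = 2^-103, odd 320/640/2048, kit precision S 2^320 / c 310 / Kpi 160 / Kser 190 / Kexp 55 / J 150; pairs with A g24 trialUpper1035sharp = 21e-33; see HOME(B)/CELL14-LSIDE-B-g21.md §4. Generated by sr-gb-rung-a prover A g22 with rh-explicit-weil-2 gen7's generator extended for the odd λ-run (--sector odd --mu-log2; HOME(A)/code-g22/gen7/gramgen7.py sha16 b21c15hp1060001) from `#eval` of the tree's `Encl` functions; every datum is re-verified by the kernel in the theorem files (`decide +kernel`). Helper data of the rh-explicit Weil-positivity programme (format C, K-CELL-2), RH-free. [cite: Yoshida1992HermitianForms, §5 (5.15)-(5.16) p. 301; §7 pp. 305–312]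
-/

set_option linter.dupNamespace false
set_option exponentiation.threshold 1024
set_option maxRecDepth 200000

namespace Summit.RiemannHypothesis.RiemannHypothesis.Theorems.WeilFormatCData.O106CBOdd
open Literature.NumberTheory.LFunctions Literature.NumberTheory.LFunctions.Yoshida1992 Encl Literature.Analysis.ValidatedNumerics.NumericsMP
open Summit.RiemannHypothesis.RiemannHypothesis.Theorems.WeilFormatCData.O106

/-- kernel: Schur rows `[78, 85)` (columns `j ≤ i`). -/
theorem tS78 : checkSchurBandG (2 ^ 320) 310 O106CBOdd.rho O106.C O106.tab true 320 (subBoxCB (2 ^ 320) 157 320 154 64 O106CBOdd.ρc O106CBOdd.XP O106CBOdd.Pd O106CBOdd.v O106CBOdd.V 151 8 148 148 O106CBOdd.ρφ O106CBOdd.ρψ O106CBOdd.ΦP O106CBOdd.ΨP O106CBOdd.Pφ O106CBOdd.Pψ (fun i ↦ (dMidOBox (2 ^ 320) O106.C O106.F (tget O106.tab (i + 1)) 1 1024 320 4 O106.momO i).add (dgJoBoxT (2 ^ 320) O106.C O106.F (tget O106.tab (i + 1)) 40 1593215978434 320 2048 4 1 2048 i))) O106CBOdd.DS true 78 7 = true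 := by
  decide +kernel

end Summit.RiemannHypothesis.RiemannHypothesis.Theorems.WeilFormatCData.O106CBOdd
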